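import Literature.MathematicalPhysics.QuantumFieldTheory.QCDPhaseQuenchedPositivity
import Literature.MathematicalPhysics.QuantumFieldTheory.QCDWickMinorMeasurability
import HarnessLib

/-!
# The Wilson quark propagator cannot be small on a whole nearest-neighbour star (every bare mass)

Topic `Literature/MathematicalPhysics/QuantumFieldTheory`; namespace
`Literature.MathematicalPhysics.QuantumFieldTheory`.  Companion of
`QCDPropagatorDiagonalLowerBound.lean` (the `n = 0` pin `(12m/(m+8)²)^s ≤ E_{|w|}[(Σ|G_f(0,0)|)^s]`,
valid ONLY at positive bare mass): here a lower bound valid at EVERY real bare mass, every gauge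
field, every coupling and every volume, at the price of involving the source site together with
its eight nearest neighbours.

* §1 (one flavour, any unitary colour representation `ρ`, any periodic four-torus, any gauge
  field, Wilson parameter `r = 1`, any real bare mass `m` with `det D_W ≠ 0`): the row identity
  `Σ_q G(p,q) D_W(q,p) = 1` of `G = D_W⁻¹` and the entry bounds `|D_W(q,p)| ≤ |m+4| δ_{qp}`
  (diagonal), `≤ 1` per nearest-neighbour relation (`|(1∓γ_μ)_{ij}|/2 ≤ 1`, `|ρ(U)_{ab}| ≤ 1`)
  give `1 ≤ |m+4|·|G(p,p)| + Σ_μ Σ_{b,j} (|G(p,(x+μ̂,b,j))| + |G(p,(x−μ̂,b,j))|)` for every index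
  `p = (x,a,i)` (`wilsonPropagator_row_sumRule`), hence for the colour–spin block sums
  `X(y) := Σ_{a,i,b,j} |G((x,a,i),(y,b,j))|` the STAR SUM RULE
  `4N ≤ |m+4|·X(x) + Σ_μ (X(x+μ̂) + X(x−μ̂))` (`wilsonPropagator_blockSum_sumRule`).
* §2 (`N_f` flavours, `SU(3)`, the tree's `diracMatrix`, phase-quenched expectation written as the
  literal `|det|`-weighted quotient of the QCD theses, torus side `2S+1`, source `0`): for
  `0 < s ≤ 1`, by subadditivity of `t ↦ t^s` and integration against the non-negative weight
  `|det D(U)|` (which kills the configurations where `G` is undefined),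
  `12^s ≤ |m_f+4|^s · E_{|w|,β,S}[(Σ|G_f(0,0)|)^s] + Σ_μ (E_{|w|,β,S}[(Σ|G_f(0,μ̂)|)^s] + E_{|w|,β,S}[(Σ|G_f(0,−μ̂)|)^s])`
  for EVERY bare-mass tuple, coupling `β`, volume and flavour
  (`phaseQuenched_starMoment_ge`): the nine phase-quenched fractional moments on the unit star
  of the source cannot all be small — uniformly in everything.

Elementary (`D D⁻¹ = 1` plus the triangle inequality); written for the harness by a stub-worker of
prover-line-stmt-QuantumFields-11513-1 (crux `OneScaleTrajectory`, line `threshold-tuned-witness`,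
2026-08-16) as the mass-uniform part of the `n ∈ {0,1}` entries of that crux's lower pin (iii).
Not here: a lower bound on any SINGLE one of the nine moments at bare mass `≤ 0` (that needs
control of the distribution of the self-energy `D_{0,∂}D_{∂∂}⁻¹D_{∂,0}` under the interacting
measure and is open), hypercubic symmetry (which would reduce the eight neighbour terms to one).
-/

noncomputable section

namespace Literature.MathematicalPhysics.QuantumFieldTheory

open scoped BigOperators
open MeasureTheory Filter Set
open Literature.MathematicalPhysics.QuantumLattice Literature.Probability.LatticeModels

/-! ### §1 The star sum rule for one Wilson flavour, configuration-wise -/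

section Torus

variable {L N : ℕ} [NeZero L] {G : Type*} [Group G] (ρ : G →* Matrix (Fin N) (Fin N) ℂ)

open Matrix

/-- The Euclidean gamma matrices are unitary (`γ_μᴴ γ_μ = γ_μ² = 1`). [folklore] -/
private theorem starRule_euclideanGamma_mem_unitaryGroup (μ : Fin 4) :
    euclideanGamma μ ∈ Matrix.unitaryGroup (Fin 4) ℂ := by
  rw [Matrix.mem_unitaryGroup_iff', star_eq_conjTranspose, (euclideanGamma_isHermitian μ).eq,
    euclideanGamma_mul_self]

/-- Entries of the gamma matrices have modulus `≤ 1`. [folklore] -/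
private theorem starRule_norm_euclideanGamma_apply_le (μ : Fin 4) (i j : Fin 4) : ‖euclideanGamma μ i j‖ ≤ 1 :=
  entry_norm_bound_of_unitary (starRule_euclideanGamma_mem_unitaryGroup μ) i j

/-- Entries of the `4 × 4` identity have modulus `≤ 1`. [folklore] -/
private theorem starRule_norm_one_apply_fin_four_le (i j : Fin 4) : ‖(1 : Matrix (Fin 4) (Fin 4) ℂ) i j‖ ≤ 1 := by
  rw [Matrix.one_apply]
  split_ifs <;> simp

/-- `|(r·1 - γ_μ)_{ij}| ≤ 2` at `r = 1`. [folklore] -/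
theorem norm_wilsonSpinMinus_apply_le (μ : Fin 4) (i j : Fin 4) :
    ‖((((1 : ℝ) : ℂ)) • (1 : Matrix (Fin 4) (Fin 4) ℂ) - euclideanGamma μ) i j‖ ≤ 2 := by
  rw [Matrix.sub_apply, Matrix.smul_apply, Complex.ofReal_one, one_smul]
  exact (norm_sub_le _ _).trans
    (by linarith [starRule_norm_one_apply_fin_four_le i j, starRule_norm_euclideanGamma_apply_le μ i j])

/-- `|(r·1 + γ_μ)_{ij}| ≤ 2` at `r = 1`. [folklore] -/
theorem norm_wilsonSpinPlus_apply_le (μ : Fin 4) (i j : Fin 4) :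
    ‖((((1 : ℝ) : ℂ)) • (1 : Matrix (Fin 4) (Fin 4) ℂ) + euclideanGamma μ) i j‖ ≤ 2 := by
  rw [Matrix.add_apply, Matrix.smul_apply, Complex.ofReal_one, one_smul]
  exact (norm_add_le _ _).trans
    (by linarith [starRule_norm_one_apply_fin_four_le i j, starRule_norm_euclideanGamma_apply_le μ i j])

omit [NeZero L] in
/-- **Entry bound for the Wilson–Dirac matrix** (`r = 1`, unitary `ρ`): `|D_W(q,p)|` is at most
`|m+4|` on the diagonal plus one unit for each of the (at most eight) nearest-neighbour relations
`q = p ∓ μ̂` between the sites (`|(1∓γ_μ)_{ij}|/2 · |ρ(U)_{ab}| ≤ 1`). [folklore] -/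
theorem norm_wilsonDirac_apply_le (hρ : ∀ g, ρ g ∈ Matrix.unitaryGroup (Fin N) ℂ)
    (U : GaugeConfig 4 L G) (m : ℝ) (q p : TorusSite 4 L × Fin N × Fin 4) :
    ‖wilsonDirac ρ U m 1 q p‖ ≤
      |m + 4| * (if q = p then 1 else 0) +
        ∑ μ : Fin 4, ((if q.1 = p.1 + Pi.single μ 1 then (1 : ℝ) else 0) +
          (if q.1 = p.1 - Pi.single μ 1 then (1 : ℝ) else 0)) := by
  rw [wilsonDirac, Matrix.of_apply]
  refine (norm_sub_le _ _).trans (add_le_add ?_ ?_)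
  · split_ifs with h
    · rw [Complex.norm_real, Real.norm_eq_abs, mul_one, mul_one]
    · simp
  · -- the hopping terms
    have hA : ∀ μ : Fin 4,
        ‖(if p.1 = QuantumFieldTheory.Site.shift q.1 μ then
            ((((1 : ℝ) : ℂ)) • (1 : Matrix (Fin 4) (Fin 4) ℂ) - euclideanGamma μ) q.2.2 p.2.2 *
              ρ (U (q.1, μ)) q.2.1 p.2.1 else 0)‖ ≤
          2 * (if q.1 = p.1 - Pi.single μ 1 then (1 : ℝ) else 0) := by
      intro μ
      split_ifs with h1 h2 h2
      · rw [norm_mul]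
        exact mul_le_mul (norm_wilsonSpinMinus_apply_le μ _ _)
          (entry_norm_bound_of_unitary (hρ _) _ _) (norm_nonneg _) (by norm_num)
      · exact absurd (by rw [h1, QuantumFieldTheory.Site.shift, add_sub_cancel_right]) h2
      · simp
      · simp
    have hB : ∀ μ : Fin 4,
        ‖(if q.1 = QuantumFieldTheory.Site.shift p.1 μ then
            ((((1 : ℝ) : ℂ)) • (1 : Matrix (Fin 4) (Fin 4) ℂ) + euclideanGamma μ) q.2.2 p.2.2 *
              ρ (U (p.1, μ))⁻¹ q.2.1 p.2.1 else 0)‖ ≤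
          2 * (if q.1 = p.1 + Pi.single μ 1 then (1 : ℝ) else 0) := by
      intro μ
      split_ifs with h1 h2 h2
      · rw [norm_mul]
        exact mul_le_mul (norm_wilsonSpinPlus_apply_le μ _ _)
          (entry_norm_bound_of_unitary (hρ _) _ _) (norm_nonneg _) (by norm_num)
      · exact absurd (by rw [h1]; rfl) h2
      · simp
      · simp
    calc ‖(1 / 2 : ℂ) * ∑ μ : Fin 4, ((if p.1 = QuantumFieldTheory.Site.shift q.1 μ then
              ((((1 : ℝ) : ℂ)) • (1 : Matrix (Fin 4) (Fin 4) ℂ) - euclideanGamma μ) q.2.2 p.2.2 *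
                ρ (U (q.1, μ)) q.2.1 p.2.1 else 0) +
            (if q.1 = QuantumFieldTheory.Site.shift p.1 μ then
              ((((1 : ℝ) : ℂ)) • (1 : Matrix (Fin 4) (Fin 4) ℂ) + euclideanGamma μ) q.2.2 p.2.2 *
                ρ (U (p.1, μ))⁻¹ q.2.1 p.2.1 else 0))‖
        = (1 / 2 : ℝ) * ‖∑ μ : Fin 4, ((if p.1 = QuantumFieldTheory.Site.shift q.1 μ then
              ((((1 : ℝ) : ℂ)) • (1 : Matrix (Fin 4) (Fin 4) ℂ) - euclideanGamma μ) q.2.2 p.2.2 *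
                ρ (U (q.1, μ)) q.2.1 p.2.1 else 0) +
            (if q.1 = QuantumFieldTheory.Site.shift p.1 μ then
              ((((1 : ℝ) : ℂ)) • (1 : Matrix (Fin 4) (Fin 4) ℂ) + euclideanGamma μ) q.2.2 p.2.2 *
                ρ (U (p.1, μ))⁻¹ q.2.1 p.2.1 else 0))‖ := by
          rw [norm_mul]
          norm_num
      _ ≤ (1 / 2 : ℝ) * ∑ μ : Fin 4, (2 * (if q.1 = p.1 - Pi.single μ 1 then (1 : ℝ) else 0) +
            2 * (if q.1 = p.1 + Pi.single μ 1 then (1 : ℝ) else 0)) := by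
          gcongr
          refine (norm_sum_le _ _).trans (Finset.sum_le_sum fun μ _ => ?_)
          exact (norm_add_le _ _).trans (add_le_add (hA μ) (hB μ))
      _ = ∑ μ : Fin 4, ((if q.1 = p.1 + Pi.single μ 1 then (1 : ℝ) else 0) +
            (if q.1 = p.1 - Pi.single μ 1 then (1 : ℝ) else 0)) := by
          rw [Finset.mul_sum]
          exact Finset.sum_congr rfl fun μ _ => by ring

/-- Row sums over a fixed sink site: `Σ_q [q.1 = y] |G(p,q)| = Σ_{b,j} |G(p,(y,b,j))|`. [folklore] -/
private theorem starRule_sum_ite_site_eq (F : TorusSite 4 L × Fin N × Fin 4 → ℝ) (y : TorusSite 4 L) :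
    ∑ q : TorusSite 4 L × Fin N × Fin 4, F q * (if q.1 = y then (1 : ℝ) else 0) =
      ∑ b : Fin N, ∑ j : Fin 4, F (y, b, j) := by
  rw [Fintype.sum_prod_type]
  simp only [mul_ite, mul_one, mul_zero]
  simp_rw [Finset.sum_ite_irrel, Finset.sum_const_zero]
  rw [Finset.sum_ite_eq' Finset.univ y, if_pos (Finset.mem_univ y), Fintype.sum_prod_type]

/-- **Row sum rule for the Wilson quark propagator** (every real bare mass, every gauge field with
`det D_W ≠ 0`, every index `p = (x,a,i)`):
`1 ≤ |m+4|·|G(p,p)| + Σ_μ Σ_{b,j} (|G(p,(x+μ̂,b,j))| + |G(p,(x−μ̂,b,j))|)`, from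
`1 = Σ_q G(p,q) D_W(q,p)` and `norm_wilsonDirac_apply_le`. [folklore] -/
theorem wilsonPropagator_row_sumRule (hρ : ∀ g, ρ g ∈ Matrix.unitaryGroup (Fin N) ℂ)
    (U : GaugeConfig 4 L G) (m : ℝ) (hdet : (wilsonDirac ρ U m 1).det ≠ 0)
    (x : TorusSite 4 L) (a : Fin N) (i : Fin 4) :
    1 ≤ |m + 4| * ‖(wilsonDirac ρ U m 1)⁻¹ (x, a, i) (x, a, i)‖ +
      ∑ μ : Fin 4, ((∑ b : Fin N, ∑ j : Fin 4,
          ‖(wilsonDirac ρ U m 1)⁻¹ (x, a, i) (x + Pi.single μ 1, b, j)‖) +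
        (∑ b : Fin N, ∑ j : Fin 4,
          ‖(wilsonDirac ρ U m 1)⁻¹ (x, a, i) (x - Pi.single μ 1, b, j)‖)) := by
  set W := wilsonDirac ρ U m 1 with hW
  set p : TorusSite 4 L × Fin N × Fin 4 := (x, a, i) with hp
  have hGW : W⁻¹ * W = 1 := Matrix.nonsing_inv_mul W (isUnit_iff_ne_zero.2 hdet)
  have h1 : ∑ q, W⁻¹ p q * W q p = 1 := by
    have := congr_fun (congr_fun hGW p) p
    rwa [Matrix.mul_apply, Matrix.one_apply_eq] at this
  have h2 : (1 : ℝ) ≤ ∑ q, ‖W⁻¹ p q‖ * ‖W q p‖ := by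
    calc (1 : ℝ) = ‖∑ q, W⁻¹ p q * W q p‖ := by rw [h1, norm_one]
      _ ≤ ∑ q, ‖W⁻¹ p q * W q p‖ := norm_sum_le _ _
      _ = ∑ q, ‖W⁻¹ p q‖ * ‖W q p‖ := by simp_rw [norm_mul]
  have h3 : ∑ q, ‖W⁻¹ p q‖ * ‖W q p‖ ≤
      ∑ q, ‖W⁻¹ p q‖ * (|m + 4| * (if q = p then 1 else 0) +
        ∑ μ : Fin 4, ((if q.1 = p.1 + Pi.single μ 1 then (1 : ℝ) else 0) +
          (if q.1 = p.1 - Pi.single μ 1 then (1 : ℝ) else 0))) :=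
    Finset.sum_le_sum fun q _ =>
      mul_le_mul_of_nonneg_left (norm_wilsonDirac_apply_le ρ hρ U m q p) (norm_nonneg _)
  -- evaluate the right-hand side
  have hdiag : ∑ q, ‖W⁻¹ p q‖ * (|m + 4| * (if q = p then (1 : ℝ) else 0)) =
      |m + 4| * ‖W⁻¹ p p‖ := by
    simp only [mul_ite, mul_one, mul_zero]
    rw [Finset.sum_ite_eq' Finset.univ p, if_pos (Finset.mem_univ p), mul_comm]
  have hplus : ∀ μ : Fin 4, ∑ q, ‖W⁻¹ p q‖ * (if q.1 = p.1 + Pi.single μ 1 then (1 : ℝ) else 0) =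
      ∑ b : Fin N, ∑ j : Fin 4, ‖W⁻¹ p (x + Pi.single μ 1, b, j)‖ := fun μ =>
    starRule_sum_ite_site_eq (fun q => ‖W⁻¹ p q‖) (x + Pi.single μ 1)
  have hminus : ∀ μ : Fin 4, ∑ q, ‖W⁻¹ p q‖ * (if q.1 = p.1 - Pi.single μ 1 then (1 : ℝ) else 0) =
      ∑ b : Fin N, ∑ j : Fin 4, ‖W⁻¹ p (x - Pi.single μ 1, b, j)‖ := fun μ =>
    starRule_sum_ite_site_eq (fun q => ‖W⁻¹ p q‖) (x - Pi.single μ 1)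
  have h4 : ∑ q, ‖W⁻¹ p q‖ * (|m + 4| * (if q = p then 1 else 0) +
        ∑ μ : Fin 4, ((if q.1 = p.1 + Pi.single μ 1 then (1 : ℝ) else 0) +
          (if q.1 = p.1 - Pi.single μ 1 then (1 : ℝ) else 0))) =
      |m + 4| * ‖W⁻¹ p p‖ +
        ∑ μ : Fin 4, ((∑ b : Fin N, ∑ j : Fin 4, ‖W⁻¹ p (x + Pi.single μ 1, b, j)‖) +
          (∑ b : Fin N, ∑ j : Fin 4, ‖W⁻¹ p (x - Pi.single μ 1, b, j)‖)) := by
    have e1 : ∀ q : TorusSite 4 L × Fin N × Fin 4,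
        ‖W⁻¹ p q‖ * (|m + 4| * (if q = p then 1 else 0) +
          ∑ μ : Fin 4, ((if q.1 = p.1 + Pi.single μ 1 then (1 : ℝ) else 0) +
            (if q.1 = p.1 - Pi.single μ 1 then (1 : ℝ) else 0))) =
        ‖W⁻¹ p q‖ * (|m + 4| * (if q = p then 1 else 0)) +
          ∑ μ : Fin 4, (‖W⁻¹ p q‖ * (if q.1 = p.1 + Pi.single μ 1 then (1 : ℝ) else 0) +
            ‖W⁻¹ p q‖ * (if q.1 = p.1 - Pi.single μ 1 then (1 : ℝ) else 0)) := by
      intro q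
      rw [mul_add, Finset.mul_sum]
      simp_rw [mul_add]
    rw [Finset.sum_congr rfl fun q _ => e1 q, Finset.sum_add_distrib, hdiag, Finset.sum_comm]
    congr 1
    refine Finset.sum_congr rfl fun μ _ => ?_
    rw [Finset.sum_add_distrib, hplus, hminus]
  have := h2.trans h3
  rw [h4] at this
  exact this

/-- Moving a triple sum's innermost index outermost. [folklore] -/
private theorem starRule_sum_sum_sum_comm_inner {α β γ : Type*} [Fintype α] [Fintype β] [Fintype γ]
    (P : α → β → γ → ℝ) :
    ∑ a, ∑ i, ∑ μ, P a i μ = ∑ μ, ∑ a, ∑ i, P a i μ :=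
  calc ∑ a, ∑ i, ∑ μ, P a i μ = ∑ a, ∑ μ, ∑ i, P a i μ :=
        Finset.sum_congr rfl fun _ _ => Finset.sum_comm
    _ = ∑ μ, ∑ a, ∑ i, P a i μ := Finset.sum_comm

/-- Bookkeeping: `Σ_{a,i} (c·d + Σ_μ (P + Q)) = c·Σ d + Σ_μ (Σ P + Σ Q)`. [folklore] -/
private theorem starRule_sum_sum_rearrange {α β γ : Type*} [Fintype α] [Fintype β] [Fintype γ] (c : ℝ)
    (d : α → β → ℝ) (P Q : α → β → γ → ℝ) :
    ∑ a, ∑ i, (c * d a i + ∑ μ, (P a i μ + Q a i μ)) =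
      c * (∑ a, ∑ i, d a i) + ∑ μ, ((∑ a, ∑ i, P a i μ) + (∑ a, ∑ i, Q a i μ)) := by
  simp only [Finset.sum_add_distrib, Finset.mul_sum]
  rw [starRule_sum_sum_sum_comm_inner P, starRule_sum_sum_sum_comm_inner Q]

/-- **Star sum rule for the colour–spin block sums of the Wilson quark propagator** (every real
bare mass, every gauge field with `det D_W ≠ 0`, every source site `x`): with
`X(y) := Σ_{a,i,b,j} |G((x,a,i),(y,b,j))|`,
`4N ≤ |m+4|·X(x) + Σ_μ (X(x+μ̂) + X(x−μ̂))`. [folklore] -/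
theorem wilsonPropagator_blockSum_sumRule (hρ : ∀ g, ρ g ∈ Matrix.unitaryGroup (Fin N) ℂ)
    (U : GaugeConfig 4 L G) (m : ℝ) (hdet : (wilsonDirac ρ U m 1).det ≠ 0) (x : TorusSite 4 L) :
    4 * (N : ℝ) ≤
      |m + 4| * (∑ a : Fin N, ∑ i : Fin 4, ∑ b : Fin N, ∑ j : Fin 4,
          ‖(wilsonDirac ρ U m 1)⁻¹ (x, a, i) (x, b, j)‖) +
        ∑ μ : Fin 4, ((∑ a : Fin N, ∑ i : Fin 4, ∑ b : Fin N, ∑ j : Fin 4,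
            ‖(wilsonDirac ρ U m 1)⁻¹ (x, a, i) (x + Pi.single μ 1, b, j)‖) +
          (∑ a : Fin N, ∑ i : Fin 4, ∑ b : Fin N, ∑ j : Fin 4,
            ‖(wilsonDirac ρ U m 1)⁻¹ (x, a, i) (x - Pi.single μ 1, b, j)‖)) := by
  set W := wilsonDirac ρ U m 1 with hW
  have hrow := fun a i => wilsonPropagator_row_sumRule ρ hρ U m hdet x a i
  -- sum the row rules over `(a, i)`
  have hsum : ∑ a : Fin N, ∑ i : Fin 4, (1 : ℝ) ≤
      ∑ a : Fin N, ∑ i : Fin 4, (|m + 4| * ‖W⁻¹ (x, a, i) (x, a, i)‖ +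
        ∑ μ : Fin 4, ((∑ b : Fin N, ∑ j : Fin 4, ‖W⁻¹ (x, a, i) (x + Pi.single μ 1, b, j)‖) +
          (∑ b : Fin N, ∑ j : Fin 4, ‖W⁻¹ (x, a, i) (x - Pi.single μ 1, b, j)‖))) :=
    Finset.sum_le_sum fun a _ => Finset.sum_le_sum fun i _ => hrow a i
  have hN : ∑ _a : Fin N, ∑ _i : Fin 4, (1 : ℝ) = 4 * (N : ℝ) := by
    simp only [Finset.sum_const, Finset.card_univ, Fintype.card_fin, nsmul_eq_mul, mul_one]
    ring
  rw [hN] at hsum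
  refine hsum.trans ?_
  -- rearrange and bound the diagonal entries by the full block sum
  have hdiag : ∀ (a : Fin N) (i : Fin 4), ‖W⁻¹ (x, a, i) (x, a, i)‖ ≤
      ∑ b : Fin N, ∑ j : Fin 4, ‖W⁻¹ (x, a, i) (x, b, j)‖ := fun a i =>
    calc ‖W⁻¹ (x, a, i) (x, a, i)‖ ≤ ∑ j : Fin 4, ‖W⁻¹ (x, a, i) (x, a, j)‖ :=
          Finset.single_le_sum (f := fun j : Fin 4 => ‖W⁻¹ (x, a, i) (x, a, j)‖)
            (fun _ _ => norm_nonneg _) (Finset.mem_univ i)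
      _ ≤ ∑ b : Fin N, ∑ j : Fin 4, ‖W⁻¹ (x, a, i) (x, b, j)‖ :=
          Finset.single_le_sum (f := fun b : Fin N => ∑ j : Fin 4, ‖W⁻¹ (x, a, i) (x, b, j)‖)
            (fun _ _ => Finset.sum_nonneg fun _ _ => norm_nonneg _) (Finset.mem_univ a)
  calc ∑ a : Fin N, ∑ i : Fin 4, (|m + 4| * ‖W⁻¹ (x, a, i) (x, a, i)‖ +
        ∑ μ : Fin 4, ((∑ b : Fin N, ∑ j : Fin 4, ‖W⁻¹ (x, a, i) (x + Pi.single μ 1, b, j)‖) +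
          (∑ b : Fin N, ∑ j : Fin 4, ‖W⁻¹ (x, a, i) (x - Pi.single μ 1, b, j)‖)))
      = |m + 4| * (∑ a : Fin N, ∑ i : Fin 4, ‖W⁻¹ (x, a, i) (x, a, i)‖) +
        ∑ μ : Fin 4, ((∑ a : Fin N, ∑ i : Fin 4, ∑ b : Fin N, ∑ j : Fin 4,
            ‖W⁻¹ (x, a, i) (x + Pi.single μ 1, b, j)‖) +
          (∑ a : Fin N, ∑ i : Fin 4, ∑ b : Fin N, ∑ j : Fin 4,
            ‖W⁻¹ (x, a, i) (x - Pi.single μ 1, b, j)‖)) :=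
        starRule_sum_sum_rearrange |m + 4| (fun a i => ‖W⁻¹ (x, a, i) (x, a, i)‖)
          (fun a i μ => ∑ b : Fin N, ∑ j : Fin 4, ‖W⁻¹ (x, a, i) (x + Pi.single μ 1, b, j)‖)
          (fun a i μ => ∑ b : Fin N, ∑ j : Fin 4, ‖W⁻¹ (x, a, i) (x - Pi.single μ 1, b, j)‖)
    _ ≤ _ := by
        gcongr with a _ i _
        exact hdiag a i

end Torus


/-! ### §2 The phase-quenched star bound for `N_f`-flavour lattice QCD -/

section QCD

/-- Subadditivity of `t ↦ t ^ s` (`0 < s ≤ 1`) over finite sums of non-negative reals. [folklore] -/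
private theorem starRule_rpow_finsetSum_le_finsetSum_rpow {ι : Type*} (T : Finset ι) (g : ι → ℝ)
    (hg : ∀ i ∈ T, 0 ≤ g i) {s : ℝ} (hs0 : 0 < s) (hs1 : s ≤ 1) :
    (∑ i ∈ T, g i) ^ s ≤ ∑ i ∈ T, g i ^ s := by
  -- adapted from Literature.Probability.Moments.rpow_sum_le_sum_rpow
  classical
  induction T using Finset.induction_on with
  | empty => simp [Real.zero_rpow hs0.ne']
  | insert a T ha ih =>
    have hg' : ∀ i ∈ T, 0 ≤ g i := fun i hi => hg i (Finset.mem_insert_of_mem hi)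
    rw [Finset.sum_insert ha, Finset.sum_insert ha]
    calc (g a + ∑ i ∈ T, g i) ^ s ≤ g a ^ s + (∑ i ∈ T, g i) ^ s :=
          Real.rpow_add_le_add_rpow (hg a (Finset.mem_insert_self a T)) (Finset.sum_nonneg hg')
            hs0.le hs1
      _ ≤ g a ^ s + ∑ i ∈ T, g i ^ s := by gcongr; exact ih hg'

/-- `t^s ≤ 1 + t` for `t ≥ 0`, `0 ≤ s ≤ 1`. [folklore] -/
private theorem starRule_rpow_le_one_add_self {t s : ℝ} (ht : 0 ≤ t) (hs0 : 0 ≤ s) (hs1 : s ≤ 1) :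
    t ^ s ≤ 1 + t := by
  rcases le_or_gt t 1 with h | h
  · exact (Real.rpow_le_one ht h hs0).trans (le_add_of_nonneg_right ht)
  · calc t ^ s ≤ t ^ (1 : ℝ) := Real.rpow_le_rpow_of_exponent_le h.le hs1
      _ = t := Real.rpow_one t
      _ ≤ 1 + t := le_add_of_nonneg_left zero_le_one

/-- The origin of `ℤ⁴` projects to the origin of the torus. [folklore] -/
private theorem starRule_torusProj_zero (L : ℕ) :
    Torus.proj L (0 : Literature.Probability.LatticeModels.Site 4) = 0 := by
  funext i
  simp [Torus.proj_apply]

/-- The unit vectors of `ℤ⁴` project to the unit vectors of the torus. [folklore] -/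
private theorem starRule_torusProj_single (L : ℕ) (μ : Fin 4) (n : ℤ) :
    Torus.proj L (Pi.single μ n : Literature.Probability.LatticeModels.Site 4) =
      Pi.single μ (n : ZMod L) := by
  funext i
  by_cases h : i = μ
  · subst h; simp [Torus.proj_apply]
  · simp [Torus.proj_apply, h]

variable {Nf : ℕ}

/-- **The phase-quenched fractional moments of the quark propagator cannot all be small on the unit
star of the source — every bare mass, coupling, volume, flavour** (tree vocabulary, the literal
`|det|`-weighted quotients of the QCD theses, torus side `2S+1`, source `0`): for `0 < s ≤ 1`,
`12^s ≤ |m_f+4|^s·E_{|w|,β,S}[(Σ_{a,i,b,j}|G_f(0,0)|)^s] + Σ_μ (E_{|w|,β,S}[(Σ|G_f(0,μ̂)|)^s] + E_{|w|,β,S}[(Σ|G_f(0,−μ̂)|)^s])`.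
Configuration-wise star sum rule `wilsonPropagator_blockSum_sumRule` (after the flavour reduction
`inv_diracMatrix_apply_same_flavour`), subadditivity of `t ↦ t^s`, integrated against the
non-negative weight `|det D(U)|` (configurations with `det D(U) = 0` carry no weight) and divided
by `∫|det D| dμ_W > 0` (`integral_norm_det_diracMatrix_pos_all`). [folklore] -/
theorem phaseQuenched_starMoment_ge (Nf : ℕ) (β : ℝ) (mq : Fin Nf → ℝ) (S : ℕ) (f : Fin Nf)
    {s : ℝ} (hs0 : 0 < s) (hs1 : s ≤ 1) :
    (12 : ℝ) ^ s ≤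
      |mq f + 4| ^ s *
          ((∫ U : GaugeConfig 4 (2 * S + 1) (Matrix.specialUnitaryGroup (Fin 3) ℂ),
              ‖(diracMatrix U mq).det‖ *
                (∑ a : Fin 3, ∑ i : Fin 4, ∑ b : Fin 3, ∑ j : Fin 4,
                  ‖(diracMatrix U mq)⁻¹ (quarkEquiv (f, (Torus.proj (2 * S + 1) 0, a, i)))
                    (quarkEquiv (f, (Torus.proj (2 * S + 1) 0, b, j)))‖) ^ s
              ∂(wilsonMeasure (fundamentalRep (Fin 3)) β)) /
            (∫ U : GaugeConfig 4 (2 * S + 1) (Matrix.specialUnitaryGroup (Fin 3) ℂ),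
              ‖(diracMatrix U mq).det‖ ∂(wilsonMeasure (fundamentalRep (Fin 3)) β))) +
        ∑ μ : Fin 4,
          ((∫ U : GaugeConfig 4 (2 * S + 1) (Matrix.specialUnitaryGroup (Fin 3) ℂ),
              ‖(diracMatrix U mq).det‖ *
                (∑ a : Fin 3, ∑ i : Fin 4, ∑ b : Fin 3, ∑ j : Fin 4,
                  ‖(diracMatrix U mq)⁻¹ (quarkEquiv (f, (Torus.proj (2 * S + 1) 0, a, i)))
                    (quarkEquiv (f, (Torus.proj (2 * S + 1) (Pi.single μ (1 : ℤ)), b, j)))‖) ^ s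
              ∂(wilsonMeasure (fundamentalRep (Fin 3)) β)) /
            (∫ U : GaugeConfig 4 (2 * S + 1) (Matrix.specialUnitaryGroup (Fin 3) ℂ),
              ‖(diracMatrix U mq).det‖ ∂(wilsonMeasure (fundamentalRep (Fin 3)) β)) +
          (∫ U : GaugeConfig 4 (2 * S + 1) (Matrix.specialUnitaryGroup (Fin 3) ℂ),
              ‖(diracMatrix U mq).det‖ *
                (∑ a : Fin 3, ∑ i : Fin 4, ∑ b : Fin 3, ∑ j : Fin 4,
                  ‖(diracMatrix U mq)⁻¹ (quarkEquiv (f, (Torus.proj (2 * S + 1) 0, a, i)))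
                    (quarkEquiv (f, (Torus.proj (2 * S + 1) (Pi.single μ (-1 : ℤ)), b, j)))‖) ^ s
              ∂(wilsonMeasure (fundamentalRep (Fin 3)) β)) /
            (∫ U : GaugeConfig 4 (2 * S + 1) (Matrix.specialUnitaryGroup (Fin 3) ℂ),
              ‖(diracMatrix U mq).det‖ ∂(wilsonMeasure (fundamentalRep (Fin 3)) β))) := by
  -- the colour–spin entry sums `X v U = Σ |G_f(0,v)(U)|`
  set X : Literature.Probability.LatticeModels.Site 4 → GaugeConfig 4 (2 * S + 1) SU3 → ℝ :=
    fun v U => ∑ a : Fin 3, ∑ i : Fin 4, ∑ b : Fin 3, ∑ j : Fin 4,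
      ‖(diracMatrix U mq)⁻¹ (quarkEquiv (f, (Torus.proj (2 * S + 1) 0, a, i)))
        (quarkEquiv (f, (Torus.proj (2 * S + 1) v, b, j)))‖ with hX
  set Z : ℝ := ∫ U : GaugeConfig 4 (2 * S + 1) SU3, ‖(diracMatrix U mq).det‖
      ∂(wilsonMeasure (fundamentalRep (Fin 3)) β) with hZdef
  have hZ : 0 < Z := integral_norm_det_diracMatrix_pos_all β mq
  have hX0 : ∀ v U, 0 ≤ X v U := fun v U =>
    Finset.sum_nonneg fun _ _ => Finset.sum_nonneg fun _ _ => Finset.sum_nonneg fun _ _ =>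
      Finset.sum_nonneg fun _ _ => norm_nonneg _
  have hXm : ∀ v, Measurable (X v) := fun v => by
    refine Finset.measurable_sum _ fun a _ => Finset.measurable_sum _ fun i _ =>
      Finset.measurable_sum _ fun b _ => Finset.measurable_sum _ fun j _ => ?_
    exact (measurable_inv_diracMatrix_apply mq _ _).norm
  -- a uniform bound on the adjugate entries, hence on `|det| · X v`
  obtain ⟨C, hC⟩ : ∃ C : ℝ, ∀ (U : GaugeConfig 4 (2 * S + 1) SU3) (p q : FermiIdx Nf (2 * S + 1)),
      ‖(diracMatrix U mq).adjugate p q‖ ≤ C := by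
    have hCpq : ∀ p q : FermiIdx Nf (2 * S + 1), ∃ C : ℝ, ∀ U : GaugeConfig 4 (2 * S + 1) SU3,
        ‖(diracMatrix U mq).adjugate p q‖ ≤ C := fun p q => by
      obtain ⟨C, hC⟩ :=
        (isCompact_univ (X := GaugeConfig 4 (2 * S + 1) SU3)).exists_bound_of_continuousOn
          (((continuous_diracMatrix (S := 2 * S + 1) mq).matrix_adjugate.matrix_elem p q).continuousOn)
      exact ⟨C, fun U => hC U (Set.mem_univ U)⟩
    choose Cf hCf using hCpq
    refine ⟨∑ p', ∑ q', |Cf p' q'|, fun U p q => ?_⟩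
    calc ‖(diracMatrix U mq).adjugate p q‖ ≤ Cf p q := hCf p q U
      _ ≤ |Cf p q| := le_abs_self _
      _ ≤ ∑ q', |Cf p q'| :=
          Finset.single_le_sum (f := fun q' => |Cf p q'|) (fun _ _ => abs_nonneg _) (Finset.mem_univ q)
      _ ≤ ∑ p', ∑ q', |Cf p' q'| :=
          Finset.single_le_sum (f := fun p' => ∑ q', |Cf p' q'|)
            (fun _ _ => Finset.sum_nonneg fun _ _ => abs_nonneg _) (Finset.mem_univ p)
  obtain ⟨B, hB⟩ := exists_norm_det_diracMatrix_le (S := 2 * S + 1) mq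
  have hdetX : ∀ v U, ‖(diracMatrix U mq).det‖ * X v U ≤ 144 * C := by
    intro v U
    rw [hX]
    simp only [Finset.mul_sum]
    calc ∑ a : Fin 3, ∑ i : Fin 4, ∑ b : Fin 3, ∑ j : Fin 4, ‖(diracMatrix U mq).det‖ *
          ‖(diracMatrix U mq)⁻¹ (quarkEquiv (f, (Torus.proj (2 * S + 1) 0, a, i)))
            (quarkEquiv (f, (Torus.proj (2 * S + 1) v, b, j)))‖
        ≤ ∑ _a : Fin 3, ∑ _i : Fin 4, ∑ _b : Fin 3, ∑ _j : Fin 4, C :=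
          Finset.sum_le_sum fun a _ => Finset.sum_le_sum fun i _ => Finset.sum_le_sum fun b _ =>
            Finset.sum_le_sum fun j _ => (norm_det_mul_norm_inv_apply_le _ _ _).trans (hC U _ _)
      _ = 144 * C := by simp; ring
  have hbound : ∀ v U, ‖X v U ^ s‖ * ‖(diracMatrix U mq).det‖ ≤ B + 144 * C := by
    intro v U
    rw [Real.norm_eq_abs, abs_of_nonneg (Real.rpow_nonneg (hX0 v U) _)]
    calc X v U ^ s * ‖(diracMatrix U mq).det‖
        ≤ (1 + X v U) * ‖(diracMatrix U mq).det‖ :=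
          mul_le_mul_of_nonneg_right (starRule_rpow_le_one_add_self (hX0 v U) hs0.le hs1) (norm_nonneg _)
      _ = ‖(diracMatrix U mq).det‖ + ‖(diracMatrix U mq).det‖ * X v U := by ring
      _ ≤ B + 144 * C := add_le_add (hB U) (hdetX v U)
  have hint : ∀ v, Integrable (fun U => ‖(diracMatrix U mq).det‖ * X v U ^ s)
      (wilsonMeasure (fundamentalRep (Fin 3)) β) := by
    intro v
    have hmeas : AEStronglyMeasurable (fun U => X v U ^ s)
        (wilsonMeasure (d := 4) (L := 2 * S + 1) (fundamentalRep (Fin 3)) β) :=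
      ((Real.continuous_rpow_const hs0.le).measurable.comp (hXm v)).aestronglyMeasurable
    refine Integrable.of_bound
      ((measurable_norm_det_diracMatrix mq).aestronglyMeasurable.mul hmeas) (B + 144 * C)
      (Eventually.of_forall fun U => ?_)
    rw [norm_mul, Real.norm_eq_abs, abs_of_nonneg (norm_nonneg _), mul_comm]
    exact hbound v U
  -- the configuration-wise star inequality, weighted by `|det|`
  have hpt : ∀ U : GaugeConfig 4 (2 * S + 1) SU3,
      ‖(diracMatrix U mq).det‖ * (12 : ℝ) ^ s ≤
        ‖(diracMatrix U mq).det‖ * (|mq f + 4| ^ s * X 0 U ^ s) +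
          ∑ μ : Fin 4, (‖(diracMatrix U mq).det‖ * X (Pi.single μ 1) U ^ s +
            ‖(diracMatrix U mq).det‖ * X (Pi.single μ (-1)) U ^ s) := by
    intro U
    by_cases hdet : (diracMatrix U mq).det = 0
    · simp [hdet]
    · have hdetf : ∀ g, (wilsonDirac (fundamentalRep (Fin 3)) U (mq g) 1).det ≠ 0 := by
        intro g hg
        apply hdet
        rw [det_diracMatrix]
        exact Finset.prod_eq_zero (Finset.mem_univ g) hg
      have hXeq : ∀ v, X v U = ∑ a : Fin 3, ∑ i : Fin 4, ∑ b : Fin 3, ∑ j : Fin 4,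
          ‖(wilsonDirac (fundamentalRep (Fin 3)) U (mq f) 1)⁻¹ (Torus.proj (2 * S + 1) 0, a, i)
            (Torus.proj (2 * S + 1) v, b, j)‖ := fun v => by
        simp only [hX, inv_diracMatrix_apply_same_flavour U mq hdetf f]
      have hstar := wilsonPropagator_blockSum_sumRule (fundamentalRep (Fin 3))
        fundamentalRep_mem_unitaryGroup U (mq f) (hdetf f) (Torus.proj (2 * S + 1) 0)
      have hplus : ∀ μ : Fin 4, Torus.proj (2 * S + 1) (0 : Literature.Probability.LatticeModels.Site 4)
          + Pi.single μ 1 = Torus.proj (2 * S + 1) (Pi.single μ (1 : ℤ)) := fun μ => by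
        rw [starRule_torusProj_zero, starRule_torusProj_single, zero_add, Int.cast_one]
      have hminus : ∀ μ : Fin 4, Torus.proj (2 * S + 1) (0 : Literature.Probability.LatticeModels.Site 4)
          - Pi.single μ 1 = Torus.proj (2 * S + 1) (Pi.single μ (-1 : ℤ)) := fun μ => by
        rw [starRule_torusProj_zero, starRule_torusProj_single, zero_sub, Int.cast_neg, Int.cast_one, Pi.single_neg]
      simp only [hplus, hminus] at hstar
      rw [← hXeq 0] at hstar
      simp only [← hXeq] at hstar
      -- hstar : 4 * 3 ≤ |mq f + 4| * X 0 U + Σ μ, (X (e μ) U + X (-e μ) U)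
      have h12 : (12 : ℝ) ≤ |mq f + 4| * X 0 U +
          ∑ μ : Fin 4, (X (Pi.single μ 1) U + X (Pi.single μ (-1)) U) := by
        have : (4 : ℝ) * ((3 : ℕ) : ℝ) = 12 := by norm_num
        rw [this] at hstar
        exact hstar
      have hT0 : 0 ≤ ∑ μ : Fin 4, (X (Pi.single μ 1) U + X (Pi.single μ (-1)) U) :=
        Finset.sum_nonneg fun μ _ => add_nonneg (hX0 _ U) (hX0 _ U)
      have hA0 : 0 ≤ |mq f + 4| * X 0 U := mul_nonneg (abs_nonneg _) (hX0 0 U)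
      have hs12 : (12 : ℝ) ^ s ≤ |mq f + 4| ^ s * X 0 U ^ s +
          ∑ μ : Fin 4, (X (Pi.single μ 1) U ^ s + X (Pi.single μ (-1)) U ^ s) :=
        calc (12 : ℝ) ^ s ≤ (|mq f + 4| * X 0 U +
              ∑ μ : Fin 4, (X (Pi.single μ 1) U + X (Pi.single μ (-1)) U)) ^ s :=
              Real.rpow_le_rpow (by norm_num) h12 hs0.le
          _ ≤ (|mq f + 4| * X 0 U) ^ s +
              (∑ μ : Fin 4, (X (Pi.single μ 1) U + X (Pi.single μ (-1)) U)) ^ s :=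
              Real.rpow_add_le_add_rpow hA0 hT0 hs0.le hs1
          _ ≤ |mq f + 4| ^ s * X 0 U ^ s +
              ∑ μ : Fin 4, (X (Pi.single μ 1) U + X (Pi.single μ (-1)) U) ^ s := by
              rw [Real.mul_rpow (abs_nonneg _) (hX0 0 U)]
              gcongr
              exact starRule_rpow_finsetSum_le_finsetSum_rpow _ _
                (fun μ _ => add_nonneg (hX0 _ U) (hX0 _ U)) hs0 hs1
          _ ≤ |mq f + 4| ^ s * X 0 U ^ s +
              ∑ μ : Fin 4, (X (Pi.single μ 1) U ^ s + X (Pi.single μ (-1)) U ^ s) := by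
              gcongr with μ _
              exact Real.rpow_add_le_add_rpow (hX0 _ U) (hX0 _ U) hs0.le hs1
      have := mul_le_mul_of_nonneg_left hs12 (norm_nonneg ((diracMatrix U mq).det))
      refine this.trans (le_of_eq ?_)
      rw [mul_add, Finset.mul_sum]
      refine congrArg _ (Finset.sum_congr rfl fun μ _ => ?_)
      rw [mul_add]
  -- integrate
  have hI : Z * (12 : ℝ) ^ s ≤
      |mq f + 4| ^ s * (∫ U, ‖(diracMatrix U mq).det‖ * X 0 U ^ s
          ∂(wilsonMeasure (fundamentalRep (Fin 3)) β)) +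
        ∑ μ : Fin 4, ((∫ U, ‖(diracMatrix U mq).det‖ * X (Pi.single μ 1) U ^ s
            ∂(wilsonMeasure (fundamentalRep (Fin 3)) β)) +
          (∫ U, ‖(diracMatrix U mq).det‖ * X (Pi.single μ (-1)) U ^ s
            ∂(wilsonMeasure (fundamentalRep (Fin 3)) β))) := by
    have hsumInt : Integrable (fun U => ∑ μ : Fin 4,
        (‖(diracMatrix U mq).det‖ * X (Pi.single μ 1) U ^ s +
          ‖(diracMatrix U mq).det‖ * X (Pi.single μ (-1)) U ^ s))
        (wilsonMeasure (fundamentalRep (Fin 3)) β) :=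
      integrable_finsetSum _ fun μ _ => (hint _).add (hint _)
    have hAint : Integrable (fun U => ‖(diracMatrix U mq).det‖ * (|mq f + 4| ^ s * X 0 U ^ s))
        (wilsonMeasure (fundamentalRep (Fin 3)) β) := by
      have := (hint 0).const_mul (|mq f + 4| ^ s)
      refine this.congr (Eventually.of_forall fun U => ?_)
      simp only
      ring
    calc Z * (12 : ℝ) ^ s
        = ∫ U, ‖(diracMatrix U mq).det‖ * (12 : ℝ) ^ s
            ∂(wilsonMeasure (fundamentalRep (Fin 3)) β) := by
          rw [integral_mul_const]
      _ ≤ ∫ U, (‖(diracMatrix U mq).det‖ * (|mq f + 4| ^ s * X 0 U ^ s) +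
            ∑ μ : Fin 4, (‖(diracMatrix U mq).det‖ * X (Pi.single μ 1) U ^ s +
              ‖(diracMatrix U mq).det‖ * X (Pi.single μ (-1)) U ^ s))
            ∂(wilsonMeasure (fundamentalRep (Fin 3)) β) :=
          integral_mono ((integrable_norm_det_diracMatrix mq _).mul_const _) (hAint.add hsumInt) hpt
      _ = _ := by
          have hswap : (∫ U, ∑ μ : Fin 4,
              (‖(diracMatrix U mq).det‖ * X (Pi.single μ 1) U ^ s +
                ‖(diracMatrix U mq).det‖ * X (Pi.single μ (-1)) U ^ s)
              ∂(wilsonMeasure (fundamentalRep (Fin 3)) β)) =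
              ∑ μ : Fin 4, ∫ U, (‖(diracMatrix U mq).det‖ * X (Pi.single μ 1) U ^ s +
                ‖(diracMatrix U mq).det‖ * X (Pi.single μ (-1)) U ^ s)
                ∂(wilsonMeasure (fundamentalRep (Fin 3)) β) :=
            integral_finsetSum _ fun μ _ => (hint _).add (hint _)
          rw [integral_add hAint hsumInt, hswap]
          congr 1
          · rw [← integral_const_mul]
            refine integral_congr_ae (Eventually.of_forall fun U => ?_)
            simp only
            ring
          · exact Finset.sum_congr rfl fun μ _ => integral_add (hint _) (hint _)
  -- divide by `Z`
  have hfin : (12 : ℝ) ^ s ≤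
      (|mq f + 4| ^ s * (∫ U, ‖(diracMatrix U mq).det‖ * X 0 U ^ s
          ∂(wilsonMeasure (fundamentalRep (Fin 3)) β)) +
        ∑ μ : Fin 4, ((∫ U, ‖(diracMatrix U mq).det‖ * X (Pi.single μ 1) U ^ s
            ∂(wilsonMeasure (fundamentalRep (Fin 3)) β)) +
          (∫ U, ‖(diracMatrix U mq).det‖ * X (Pi.single μ (-1)) U ^ s
            ∂(wilsonMeasure (fundamentalRep (Fin 3)) β)))) / Z := by
    rw [le_div_iff₀ hZ, mul_comm]
    exact hI
  refine hfin.trans (le_of_eq ?_)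
  rw [add_div, Finset.sum_div, mul_div_assoc]
  exact congrArg _ (Finset.sum_congr rfl fun μ _ => add_div _ _ _)

end QCD

end Literature.MathematicalPhysics.QuantumFieldTheory

end
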